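import Summits.CriticalPhenomena.PercolationContinuityZ3.Theorems.PercNearOneGluingNoHeavyLowerTailAntitheticConesHangingSinks
import HarnessLib

/-!
# `NoHeavyLowerTail` (stmt-CriticalPhenomena-4575) — antithetic cluster pairs: the PENDANT-EDGE LEMMA — `T_E(R,X) ≥ 0 for all increasing
# F, G` is invariant under attaching or deleting a pendant edge (prim-hp-2 gen 39; HOME/MEMO-gen39-pendant.md)

Support file (`--supports stmt-CriticalPhenomena-4575`, hull-port prover `prim-hp-2`, gen 39).  No named facts, no sorries; standard axioms.
The `def` `Antithetic.Pendant.liftSet` is proof-internal bookkeeping.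

SETTING (MEMO-gen31 §1, file …AntitheticPeelTools): colourings `ω ⊆ Sym2 V` (`ω ∩ E` red, `ωᶜ ∩ E` blue), source `s`,
`Δ(ω) = (F(C_s(ω∩E)) − F(C_s(ωᶜ∩E)))·(G(C_s(ω∩E)) − G(C_s(ωᶜ∩E)))`, `T_E(R,X) = Σ_{ω ∈ tset} Δ(ω)` over the colourings in which no vertex of
`R` is joined to `s` in both colours and no vertex of `X` in either (`Peel.tsum`; `T_E(R,∅) = BIC_E(R)`).  Call `(E,R,X)` GOOD if
`T_E(R,X) ≥ 0` for ALL increasing `F, G`.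

THE PENDANT-EDGE LEMMA.  Let `e = uℓ` with `ℓ ≠ s`, `ℓ ∉ X`, `u ≠ ℓ`, and `ℓ` meeting no pair of `E` except loops.  Then
`(E, R, X)` is good iff `(E ∪ {e}, R, X)` is good (`Pendant.good_insert`, `Pendant.good_of_insert`).  Consequently goodness is invariant
under hanging or pruning FORESTS anywhere away from `s` and `X` (`Pendant.good_chain`), and every class theorem of the programme (cones,
clique-apex cones, a universal vertex, …) extends to the class "modulo pendant trees" (file …AntitheticULeaf: THEOREMS U′, I′).
PROOF.  Write `x, y` for the red/blue clusters of a colouring of `E` and `ρ(C) = [u = s ∨ u ∈ ⋃ C]` ("`u` is reached by the cluster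
`C`"), `C⁺ = C ∪ {e}` if `ρ(C)` else `C` (`liftSet`), `F⁺ = F ∘ (·)⁺` (increasing).  The two colourings of `E ∪ {e}` above a colouring of
`E` have clusters `(x⁺, y)` and `(x, y⁺)` (`Pendant.openEdgeCluster_insert`), the constraint set does not change (`Pendant.tset_insert`), and
with `δ = F⁺ − F ≥ 0`, `ε = G⁺ − G ≥ 0` one has the identity (`ring`)
`(F⁺x − Fy)(G⁺x − Gy) + (Fx − F⁺y)(Gx − G⁺y) = ½ (Φx − Φy)(Ψx − Ψy) + ½ (δx + δy)(εx + εy)`,  `Φ = F + F⁺`, `Ψ = G + G⁺`,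
so `2·T_{E∪e}(R,X; F,G) ≥ ½·T_E(R,X; Φ,Ψ) ≥ 0`.  Conversely `T_E(R,X; F,G) = T_{E∪e}(R,X; F(· ∩ E), G(· ∩ E))` exactly.
[cite: VandenbergHaggstromKahn2005, §1 p. 3 (open cluster `C_s`)]
-/

noncomputable section

namespace Summit.CriticalPhenomena.PercolationContinuityZ3.Theorems

open Literature.Probability.Percolation
open scoped Classical symmDiff

namespace Antithetic

namespace Pendant

variable {V : Type*}

section Graph

variable (η : Set (Sym2 V)) (u ℓ : V)

/-- Walks in `η ∪ {uℓ}` for a vertex `ℓ` meeting only loops of `η`: between vertices other than `ℓ` they may be replaced by walks of `η`, and a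
walk to `ℓ` ends with the new pair. [folklore] -/
theorem reach_cases (hℓ : ∀ f ∈ η, ℓ ∈ f → f.IsDiag) (huℓ : u ≠ ℓ) {a b : V}
    (h : (openGraph (insert s(u, ℓ) η)).Reachable a b) :
    (a ≠ ℓ → b ≠ ℓ → (openGraph η).Reachable a b) ∧ (a ≠ ℓ → b = ℓ → (openGraph η).Reachable a u) ∧
      (a = ℓ → b ≠ ℓ → (openGraph η).Reachable u b) := by
  obtain ⟨p⟩ := h
  induction p with
  | nil => exact ⟨fun _ _ => SimpleGraph.Reachable.refl _, fun h1 h2 => (h1 h2).elim, fun h1 h2 => (h2 h1).elim⟩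
  | cons hadj p ih =>
    rename_i a a' b
    rw [openGraph_adj, Set.mem_insert_iff] at hadj
    obtain ⟨hE | hE, hne⟩ := hadj
    · rcases Sym2.eq_iff.1 hE with ⟨rfl, rfl⟩ | ⟨rfl, rfl⟩
      · exact ⟨fun _ hb => ih.2.2 rfl hb, fun _ _ => SimpleGraph.Reachable.refl _, fun h => (huℓ h).elim⟩
      · exact ⟨fun h => (h rfl).elim, fun h => (h rfl).elim, fun _ hb => ih.1 huℓ hb⟩
    · have ha' : a' ≠ ℓ := by
        rintro rfl
        exact hne (Sym2.mk_isDiag_iff.1 (hℓ _ hE (Sym2.mem_mk_right _ _)))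
      have ha : a ≠ ℓ := by
        rintro rfl
        exact hne (Sym2.mk_isDiag_iff.1 (hℓ _ hE (Sym2.mem_mk_left _ _)))
      have har : (openGraph η).Reachable a a' := ((openGraph_adj η a a').2 ⟨hE, hne⟩).reachable
      exact ⟨fun _ hb => har.trans (ih.1 ha' hb), fun _ hb => har.trans (ih.2.1 ha' hb), fun h => (ha h).elim⟩

/-- Attaching the pendant pair `uℓ` does not change reachability between vertices other than `ℓ`. [folklore] -/
theorem reachable_iff (hℓ : ∀ f ∈ η, ℓ ∈ f → f.IsDiag) (huℓ : u ≠ ℓ) {a b : V} (ha : a ≠ ℓ) (hb : b ≠ ℓ) :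
    (openGraph (insert s(u, ℓ) η)).Reachable a b ↔ (openGraph η).Reachable a b :=
  ⟨fun h => (reach_cases η u ℓ hℓ huℓ h).1 ha hb, fun h => h.mono (SimpleGraph.fromEdgeSet_mono (Set.subset_insert _ _))⟩

/-- After attaching the pendant pair `uℓ`, the leaf `ℓ` is reached from `a ≠ ℓ` iff `u` was. [folklore] -/
theorem reachable_leaf_iff (hℓ : ∀ f ∈ η, ℓ ∈ f → f.IsDiag) (huℓ : u ≠ ℓ) {a : V} (ha : a ≠ ℓ) :
    (openGraph (insert s(u, ℓ) η)).Reachable a ℓ ↔ (openGraph η).Reachable a u :=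
  ⟨fun h => (reach_cases η u ℓ hℓ huℓ h).2.1 ha rfl, fun h =>
    (h.mono (SimpleGraph.fromEdgeSet_mono (Set.subset_insert _ _))).trans
      ((openGraph_adj _ u ℓ).2 ⟨Set.mem_insert _ _, huℓ⟩).reachable⟩

/-- A vertex meeting only loops is reached only from itself. [folklore] -/
theorem not_reachable_leaf (hℓ : ∀ f ∈ η, ℓ ∈ f → f.IsDiag) {a : V} (ha : a ≠ ℓ) : ¬ (openGraph η).Reachable a ℓ :=
  fun h => ha (Peel.eq_of_reachable_isolated η hℓ h)

/-- `u` is reached from `s` iff `u = s` or `u` is an endpoint of an edge of the edge cluster of `s`.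
[cite: VandenbergHaggstromKahn2005, §1 p. 3 (open cluster `C_s`)] -/
theorem reachable_iff_cluster (s : V) : (openGraph η).Reachable s u ↔ (u = s ∨ ∃ f ∈ openEdgeCluster η s, u ∈ f) := by
  constructor
  · rintro ⟨p⟩
    cases hp : p.reverse with
    | nil => exact Or.inl rfl
    | cons hadj q =>
      rename_i w
      right
      rw [openGraph_adj] at hadj
      refine ⟨s(u, w), ⟨hadj.1, by rw [Sym2.mk_isDiag_iff]; exact hadj.2, fun v hv => ?_⟩, Sym2.mem_mk_left _ _⟩
      rcases Sym2.mem_iff.1 hv with rfl | rfl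
      · exact ⟨p⟩
      · exact ⟨q.reverse⟩
  · rintro (rfl | ⟨f, hf, huf⟩)
    exacts [SimpleGraph.Reachable.refl _, hf.2.2 u huf]

end Graph

/-- `C⁺`: the cluster `C` with the pendant pair `e` added when its base `u` is reached by `C` (`u = s` or `u` an endpoint of an edge of `C`).
[this work] -/
def liftSet (s u : V) (e : Sym2 V) (C : Set (Sym2 V)) : Set (Sym2 V) :=
  if u = s ∨ ∃ f ∈ C, u ∈ f then insert e C else C

section Lift

variable (s u : V) (e : Sym2 V)

/-- `C ⊆ C⁺`. [this work] -/
theorem subset_liftSet (C : Set (Sym2 V)) : C ⊆ liftSet s u e C := by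
  unfold liftSet; split_ifs; exacts [Set.subset_insert _ _, le_rfl]

/-- `C ↦ C⁺` is increasing. [this work] -/
theorem liftSet_mono : Monotone (liftSet s u e : Set (Sym2 V) → Set (Sym2 V)) := by
  intro C D hCD
  change liftSet s u e C ⊆ liftSet s u e D
  unfold liftSet
  by_cases hC : u = s ∨ ∃ f ∈ C, u ∈ f
  · have hD : u = s ∨ ∃ f ∈ D, u ∈ f := hC.imp id fun ⟨f, hf, huf⟩ => ⟨f, hCD hf, huf⟩
    rw [if_pos hC, if_pos hD]
    exact Set.insert_subset_insert hCD
  · rw [if_neg hC]; split_ifs; exacts [hCD.trans (Set.subset_insert _ _), hCD]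

/-- `F ∘ (·)⁺` is increasing for increasing `F`. [this work] -/
theorem monotone_lift {F : Set (Sym2 V) → ℝ} (hF : Monotone F) : Monotone fun C => F (liftSet s u e C) :=
  fun _ _ hCD => hF (liftSet_mono s u e hCD)

/-- `F + F ∘ (·)⁺` is increasing for increasing `F`. [this work] -/
theorem monotone_add_lift {F : Set (Sym2 V) → ℝ} (hF : Monotone F) : Monotone fun C => F C + F (liftSet s u e C) :=
  fun _ _ hCD => add_le_add (hF hCD) (hF (liftSet_mono s u e hCD))

/-- `C⁺ ∩ E = C` for `C ⊆ E ∌ e`. [this work] -/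
theorem liftSet_inter {E C : Set (Sym2 V)} (hC : C ⊆ E) (he : e ∉ E) : liftSet s u e C ∩ E = C := by
  unfold liftSet; split_ifs
  exacts [by rw [Set.insert_inter_of_notMem he, Set.inter_eq_left.2 hC], Set.inter_eq_left.2 hC]

end Lift

section Cluster

variable (E : Set (Sym2 V)) (s u ℓ : V)

/-- The pendant pair is not a pair of `E`. [this work] -/
theorem pair_not_mem (hℓ : ∀ f ∈ E, ℓ ∈ f → f.IsDiag) (huℓ : u ≠ ℓ) : s(u, ℓ) ∉ E :=
  fun h => huℓ (Sym2.mk_isDiag_iff.1 (hℓ _ h (Sym2.mem_mk_right _ _)))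

/-- **The edge cluster after attaching a pendant pair** `uℓ` (open): `C_s(η ∪ {uℓ}) = C_s(η)⁺`. [this work] -/
theorem openEdgeCluster_insert (η : Set (Sym2 V)) (hℓ : ∀ f ∈ η, ℓ ∈ f → f.IsDiag) (huℓ : u ≠ ℓ) (hsℓ : s ≠ ℓ) :
    openEdgeCluster (insert s(u, ℓ) η) s = liftSet s u s(u, ℓ) (openEdgeCluster η s) := by
  have hR : ∀ v, v ≠ ℓ → ((openGraph (insert s(u, ℓ) η)).Reachable s v ↔ (openGraph η).Reachable s v) :=
    fun v hv => reachable_iff η u ℓ hℓ huℓ hsℓ hv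
  have hL : (openGraph (insert s(u, ℓ) η)).Reachable s ℓ ↔ (openGraph η).Reachable s u := reachable_leaf_iff η u ℓ hℓ huℓ hsℓ
  have hne : ∀ f ∈ η, ¬ f.IsDiag → ∀ v ∈ f, v ≠ ℓ := fun f hf hd v hv h => hd (hℓ f hf (h ▸ hv))
  ext f
  rw [mem_openEdgeCluster_iff, liftSet]
  by_cases hu : (openGraph η).Reachable s u
  · rw [if_pos ((reachable_iff_cluster η u s).1 hu), Set.mem_insert_iff, Set.mem_insert_iff, mem_openEdgeCluster_iff]
    constructor
    · rintro ⟨rfl | hf, hd, hr⟩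
      · exact Or.inl rfl
      · exact Or.inr ⟨hf, hd, fun v hv => (hR v (hne f hf hd v hv)).1 (hr v hv)⟩
    · rintro (rfl | ⟨hf, hd, hr⟩)
      · refine ⟨Or.inl rfl, by rw [Sym2.mk_isDiag_iff]; exact huℓ, fun v hv => ?_⟩
        rcases Sym2.mem_iff.1 hv with rfl | rfl
        · exact (hR _ huℓ).2 hu
        · exact hL.2 hu
      · exact ⟨Or.inr hf, hd, fun v hv => (hR v (hne f hf hd v hv)).2 (hr v hv)⟩
  · rw [if_neg (fun h => hu ((reachable_iff_cluster η u s).2 h)), mem_openEdgeCluster_iff, Set.mem_insert_iff]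
    constructor
    · rintro ⟨rfl | hf, hd, hr⟩
      · exact absurd ((hR u huℓ).1 (hr u (Sym2.mem_mk_left _ _))) hu
      · exact ⟨hf, hd, fun v hv => (hR v (hne f hf hd v hv)).1 (hr v hv)⟩
    · rintro ⟨hf, hd, hr⟩
      exact ⟨Or.inr hf, hd, fun v hv => (hR v (hne f hf hd v hv)).2 (hr v hv)⟩

variable {E s u ℓ}

/-- Reachability of a vertex `r ≠ ℓ` in the colouring `ω` of `E ∪ {uℓ}` equals that in the colouring `ω` of `E`. [this work] -/
theorem reachable_col_iff (hℓ : ∀ f ∈ E, ℓ ∈ f → f.IsDiag) (huℓ : u ≠ ℓ) (hsℓ : s ≠ ℓ) (ω : Set (Sym2 V)) {r : V} (hr : r ≠ ℓ) :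
    (openGraph (ω ∩ insert s(u, ℓ) E)).Reachable s r ↔ (openGraph (ω ∩ E)).Reachable s r := by
  by_cases he : s(u, ℓ) ∈ ω
  · rw [Set.inter_insert_of_mem he]
    exact reachable_iff (ω ∩ E) u ℓ (fun f hf => hℓ f hf.2) huℓ hsℓ hr
  · rw [Set.inter_insert_of_notMem he]

/-- The leaf `ℓ` is reached in the colouring `ω` of `E ∪ {uℓ}` iff `uℓ ∈ ω` and `u` is reached in the colouring `ω` of `E`. [this work] -/
theorem reachable_col_leaf_iff (hℓ : ∀ f ∈ E, ℓ ∈ f → f.IsDiag) (huℓ : u ≠ ℓ) (hsℓ : s ≠ ℓ) (ω : Set (Sym2 V)) :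
    (openGraph (ω ∩ insert s(u, ℓ) E)).Reachable s ℓ ↔ (s(u, ℓ) ∈ ω ∧ (openGraph (ω ∩ E)).Reachable s u) := by
  by_cases he : s(u, ℓ) ∈ ω
  · rw [Set.inter_insert_of_mem he, reachable_leaf_iff (ω ∩ E) u ℓ (fun f hf => hℓ f hf.2) huℓ hsℓ]
    exact (iff_of_eq (true_and _).symm).trans (by rw [eq_true he])
  · rw [Set.inter_insert_of_notMem he]
    exact iff_of_false (not_reachable_leaf (ω ∩ E) ℓ (fun f hf => hℓ f hf.2) hsℓ) fun h => he h.1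

/-- The leaf is never reached in both colours. [this work] -/
theorem not_both_leaf (hℓ : ∀ f ∈ E, ℓ ∈ f → f.IsDiag) (huℓ : u ≠ ℓ) (hsℓ : s ≠ ℓ) (ω : Set (Sym2 V)) :
    ¬ ((openGraph (ω ∩ insert s(u, ℓ) E)).Reachable s ℓ ∧ (openGraph (ωᶜ ∩ insert s(u, ℓ) E)).Reachable s ℓ) := fun h =>
  ((reachable_col_leaf_iff hℓ huℓ hsℓ ωᶜ).1 h.2).1 ((reachable_col_leaf_iff hℓ huℓ hsℓ ω).1 h.1).1

/-- **The constraint set does not change** when a pendant pair is attached at a leaf `ℓ ≠ s`, `ℓ ∉ X`. [this work] -/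
theorem tset_insert [Fintype V] (hℓ : ∀ f ∈ E, ℓ ∈ f → f.IsDiag) (huℓ : u ≠ ℓ) (hsℓ : s ≠ ℓ) (R X : Set V) (hX : ℓ ∉ X) :
    Peel.tset (insert s(u, ℓ) E) s R X = Peel.tset E s R X := by
  ext ω
  rw [Peel.mem_tset, Peel.mem_tset]
  have hx : ∀ x ∈ X, x ≠ ℓ := fun x hx h => hX (h ▸ hx)
  constructor
  · rintro ⟨hR, hX'⟩
    refine ⟨fun r hr => ?_, fun x hxX => ?_⟩
    · by_cases hrl : r = ℓ
      · subst hrl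
        exact fun h => not_reachable_leaf (ω ∩ E) r (fun f hf => hℓ f hf.2) hsℓ h.1
      · rw [← reachable_col_iff hℓ huℓ hsℓ ω hrl, ← reachable_col_iff hℓ huℓ hsℓ ωᶜ hrl]
        exact hR r hr
    · rw [← reachable_col_iff hℓ huℓ hsℓ ω (hx x hxX), ← reachable_col_iff hℓ huℓ hsℓ ωᶜ (hx x hxX)]
      exact hX' x hxX
  · rintro ⟨hR, hX'⟩
    refine ⟨fun r hr => ?_, fun x hxX => ?_⟩
    · by_cases hrl : r = ℓ
      · subst hrl
        exact not_both_leaf hℓ huℓ hsℓ ω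
      · rw [reachable_col_iff hℓ huℓ hsℓ ω hrl, reachable_col_iff hℓ huℓ hsℓ ωᶜ hrl]
        exact hR r hr
    · rw [reachable_col_iff hℓ huℓ hsℓ ω (hx x hxX), reachable_col_iff hℓ huℓ hsℓ ωᶜ (hx x hxX)]
      exact hX' x hxX

/-- **The functional after attaching a pendant pair**: above a colouring of `E` with clusters `(x, y)` the two colourings of `E ∪ {uℓ}` have
clusters `(x⁺, y)` (pair red) and `(x, y⁺)` (pair blue). [this work] -/
theorem delta_insert (hℓ : ∀ f ∈ E, ℓ ∈ f → f.IsDiag) (huℓ : u ≠ ℓ) (hsℓ : s ≠ ℓ) (F G : Set (Sym2 V) → ℝ) (ω : Set (Sym2 V)) :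
    Peel.delta F G (insert s(u, ℓ) E) s ω =
      if s(u, ℓ) ∈ ω then
        (F (liftSet s u s(u, ℓ) (openEdgeCluster (ω ∩ E) s)) - F (openEdgeCluster (ωᶜ ∩ E) s)) *
          (G (liftSet s u s(u, ℓ) (openEdgeCluster (ω ∩ E) s)) - G (openEdgeCluster (ωᶜ ∩ E) s))
      else
        (F (openEdgeCluster (ω ∩ E) s) - F (liftSet s u s(u, ℓ) (openEdgeCluster (ωᶜ ∩ E) s))) *
          (G (openEdgeCluster (ω ∩ E) s) - G (liftSet s u s(u, ℓ) (openEdgeCluster (ωᶜ ∩ E) s))) := by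
  unfold Peel.delta
  by_cases he : s(u, ℓ) ∈ ω
  · have hec : s(u, ℓ) ∉ ωᶜ := fun h => h he
    rw [if_pos he, Set.inter_insert_of_mem he, Set.inter_insert_of_notMem hec,
      openEdgeCluster_insert s u ℓ (ω ∩ E) (fun f hf => hℓ f hf.2) huℓ hsℓ]
  · have hec : s(u, ℓ) ∈ ωᶜ := he
    rw [if_neg he, Set.inter_insert_of_notMem he, Set.inter_insert_of_mem hec,
      openEdgeCluster_insert s u ℓ (ωᶜ ∩ E) (fun f hf => hℓ f hf.2) huℓ hsℓ]

/-- **Deleting a pendant pair is exact**: `Δ_E(ω; F, G) = Δ_{E ∪ {uℓ}}(ω; F(· ∩ E), G(· ∩ E))`. [this work] -/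
theorem delta_insert_restrict (hℓ : ∀ f ∈ E, ℓ ∈ f → f.IsDiag) (huℓ : u ≠ ℓ) (hsℓ : s ≠ ℓ) (F G : Set (Sym2 V) → ℝ)
    (ω : Set (Sym2 V)) :
    Peel.delta (fun C => F (C ∩ E)) (fun C => G (C ∩ E)) (insert s(u, ℓ) E) s ω = Peel.delta F G E s ω := by
  have he : s(u, ℓ) ∉ E := pair_not_mem E u ℓ hℓ huℓ
  have h1 : openEdgeCluster (ω ∩ E) s ⊆ E := fun f hf => (openEdgeCluster_subset _ _ hf).2
  have h2 : openEdgeCluster (ωᶜ ∩ E) s ⊆ E := fun f hf => (openEdgeCluster_subset _ _ hf).2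
  rw [delta_insert hℓ huℓ hsℓ]
  unfold Peel.delta
  split_ifs
  · simp only [liftSet_inter s u _ h1 he, Set.inter_eq_left.2 h2]
  · simp only [liftSet_inter s u _ h2 he, Set.inter_eq_left.2 h1]

end Cluster

section Sums

variable [Fintype V] {E : Set (Sym2 V)} {s u ℓ : V}

/-- The pendant identity (pure algebra): with `a ≤ a⁺`, `b ≤ b⁺`, `c ≤ c⁺`, `d ≤ d⁺`,
`(a⁺ − b)(c⁺ − d) + (a − b⁺)(c − d⁺) = ½((a + a⁺) − (b + b⁺))((c + c⁺) − (d + d⁺)) + ½((a⁺ − a) + (b⁺ − b))((c⁺ − c) + (d⁺ − d))`,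
whose last term is nonnegative. [this work] -/
theorem pendant_ineq {a a' b b' c c' d d' : ℝ} (ha : a ≤ a') (hb : b ≤ b') (hc : c ≤ c') (hd : d ≤ d') :
    (1 / 2 : ℝ) * (((a + a') - (b + b')) * ((c + c') - (d + d'))) ≤ (a' - b) * (c' - d) + (a - b') * (c - d') := by
  have key : (a' - b) * (c' - d) + (a - b') * (c - d') =
      (1 / 2 : ℝ) * (((a + a') - (b + b')) * ((c + c') - (d + d'))) + (1 / 2 : ℝ) * (((a' - a) + (b' - b)) * ((c' - c) + (d' - d))) := by
    ring
  have : 0 ≤ ((a' - a) + (b' - b)) * ((c' - c) + (d' - d)) := mul_nonneg (by linarith) (by linarith)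
  rw [key]; linarith

omit [Fintype V] in
/-- Reflecting the colour of the pendant pair does not change the colouring of `E`. [this work] -/
theorem symmDiff_pair_inter (he : s(u, ℓ) ∉ E) (ω : Set (Sym2 V)) : (ω ∆ {s(u, ℓ)}) ∩ E = ω ∩ E := by
  ext f
  simp only [Set.mem_inter_iff, Set.mem_symmDiff, Set.mem_singleton_iff]
  constructor
  · rintro ⟨h | h, hf⟩
    exacts [⟨h.1, hf⟩, absurd hf (h.1 ▸ he)]
  · exact fun ⟨h, hf⟩ => ⟨Or.inl ⟨h, fun h' => he (h' ▸ hf)⟩, hf⟩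

omit [Fintype V] in
/-- Reflecting the colour of the pendant pair does not change the complementary colouring of `E`. [this work] -/
theorem compl_symmDiff_pair_inter (he : s(u, ℓ) ∉ E) (ω : Set (Sym2 V)) : (ω ∆ {s(u, ℓ)})ᶜ ∩ E = ωᶜ ∩ E := by
  ext f
  simp only [Set.mem_inter_iff, Set.mem_compl_iff, Set.mem_symmDiff, Set.mem_singleton_iff, not_or, not_and, not_not]
  exact ⟨fun ⟨⟨h1, _⟩, hf⟩ => ⟨fun h => he ((h1 h) ▸ hf), hf⟩,
    fun ⟨h, hf⟩ => ⟨⟨fun h' => absurd h' h, fun h' => absurd hf (h' ▸ he)⟩, hf⟩⟩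

/-- **PENDANT-EDGE LEMMA, quantitative form**: `¼ · T_E(R,X; F + F⁺, G + G⁺) ≤ T_{E ∪ {uℓ}}(R,X; F, G)`. [this work] -/
theorem tsum_insert_ge (hℓ : ∀ f ∈ E, ℓ ∈ f → f.IsDiag) (huℓ : u ≠ ℓ) (hsℓ : s ≠ ℓ) (R X : Set V) (hX : ℓ ∉ X)
    {F G : Set (Sym2 V) → ℝ} (hF : Monotone F) (hG : Monotone G) :
    (1 / 4 : ℝ) * Peel.tsum (fun C => F C + F (liftSet s u s(u, ℓ) C)) (fun C => G C + G (liftSet s u s(u, ℓ) C)) E s R X ≤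
      Peel.tsum F G (insert s(u, ℓ) E) s R X := by
  have he : s(u, ℓ) ∉ E := pair_not_mem E u ℓ hℓ huℓ
  unfold Peel.tsum
  rw [tset_insert hℓ huℓ hsℓ R X hX]
  -- the reflection `ω ↦ ω ∆ {uℓ}` preserves the constraint set and the clusters of `E`
  have hmem : ∀ ω, ω ∆ {s(u, ℓ)} ∈ Peel.tset E s R X ↔ ω ∈ Peel.tset E s R X := fun ω => by
    rw [Peel.mem_tset, Peel.mem_tset, symmDiff_pair_inter he, compl_symmDiff_pair_inter he]
  have hrefl : ∑ ω ∈ Peel.tset E s R X, Peel.delta F G (insert s(u, ℓ) E) s ω =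
      ∑ ω ∈ Peel.tset E s R X, Peel.delta F G (insert s(u, ℓ) E) s (ω ∆ {s(u, ℓ)}) :=
    Finset.sum_nbij' (fun ω => ω ∆ {s(u, ℓ)}) (fun ω => ω ∆ {s(u, ℓ)}) (fun ω hω => (hmem ω).2 hω) (fun ω hω => (hmem ω).2 hω)
      (fun ω _ => symmDiff_symmDiff_cancel_right _ _) (fun ω _ => symmDiff_symmDiff_cancel_right _ _)
      (fun ω _ => by rw [symmDiff_symmDiff_cancel_right])
  -- pair each colouring with its reflection and apply the pendant identity termwise
  have hpair : ∀ ω ∈ Peel.tset E s R X,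
      (1 / 2 : ℝ) * Peel.delta (fun C => F C + F (liftSet s u s(u, ℓ) C)) (fun C => G C + G (liftSet s u s(u, ℓ) C)) E s ω ≤
        Peel.delta F G (insert s(u, ℓ) E) s ω + Peel.delta F G (insert s(u, ℓ) E) s (ω ∆ {s(u, ℓ)}) := by
    intro ω _
    have hFx := hF (subset_liftSet s u s(u, ℓ) (openEdgeCluster (ω ∩ E) s))
    have hFy := hF (subset_liftSet s u s(u, ℓ) (openEdgeCluster (ωᶜ ∩ E) s))
    have hGx := hG (subset_liftSet s u s(u, ℓ) (openEdgeCluster (ω ∩ E) s))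
    have hGy := hG (subset_liftSet s u s(u, ℓ) (openEdgeCluster (ωᶜ ∩ E) s))
    rw [delta_insert hℓ huℓ hsℓ, delta_insert hℓ huℓ hsℓ, symmDiff_pair_inter he, compl_symmDiff_pair_inter he]
    unfold Peel.delta
    by_cases heω : s(u, ℓ) ∈ ω
    · have : s(u, ℓ) ∉ ω ∆ {s(u, ℓ)} := fun h => by
        rw [Set.mem_symmDiff, Set.mem_singleton_iff] at h
        exact h.elim (fun h => h.2 rfl) (fun h => h.2 heω)
      rw [if_pos heω, if_neg this]
      exact pendant_ineq hFx hFy hGx hGy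
    · have : s(u, ℓ) ∈ ω ∆ {s(u, ℓ)} := by
        rw [Set.mem_symmDiff, Set.mem_singleton_iff]; exact Or.inr ⟨rfl, heω⟩
      rw [if_neg heω, if_pos this, add_comm]
      exact pendant_ineq hFx hFy hGx hGy
  have hsum := Finset.sum_le_sum hpair
  rw [← Finset.mul_sum, Finset.sum_add_distrib, ← hrefl] at hsum
  linarith

/-- **PENDANT-EDGE LEMMA (attaching)**: if `T_E(R,X) ≥ 0` for all increasing `F, G`, then the same holds for `E ∪ {uℓ}` — `ℓ ≠ s`, `ℓ ∉ X`
a vertex meeting only loops of `E`, `u ≠ ℓ` arbitrary. [this work] -/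
theorem good_insert (hℓ : ∀ f ∈ E, ℓ ∈ f → f.IsDiag) (huℓ : u ≠ ℓ) (hsℓ : s ≠ ℓ) (R X : Set V) (hX : ℓ ∉ X)
    (hgood : ∀ F G : Set (Sym2 V) → ℝ, Monotone F → Monotone G → 0 ≤ Peel.tsum F G E s R X)
    {F G : Set (Sym2 V) → ℝ} (hF : Monotone F) (hG : Monotone G) : 0 ≤ Peel.tsum F G (insert s(u, ℓ) E) s R X := by
  have h1 := tsum_insert_ge hℓ huℓ hsℓ R X hX hF hG
  have h2 := hgood _ _ (monotone_add_lift s u s(u, ℓ) hF) (monotone_add_lift s u s(u, ℓ) hG)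
  linarith

/-- **Deleting a pendant pair is exact**: `T_E(R,X; F, G) = T_{E ∪ {uℓ}}(R,X; F(· ∩ E), G(· ∩ E))`. [this work] -/
theorem tsum_eq_tsum_insert (hℓ : ∀ f ∈ E, ℓ ∈ f → f.IsDiag) (huℓ : u ≠ ℓ) (hsℓ : s ≠ ℓ) (R X : Set V) (hX : ℓ ∉ X)
    (F G : Set (Sym2 V) → ℝ) :
    Peel.tsum F G E s R X = Peel.tsum (fun C => F (C ∩ E)) (fun C => G (C ∩ E)) (insert s(u, ℓ) E) s R X := by
  unfold Peel.tsum
  rw [tset_insert hℓ huℓ hsℓ R X hX]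
  exact Finset.sum_congr rfl fun ω _ => (delta_insert_restrict hℓ huℓ hsℓ F G ω).symm

/-- **PENDANT-EDGE LEMMA (pruning)**: if `T_{E ∪ {uℓ}}(R,X) ≥ 0` for all increasing `F, G`, then the same holds for `E`. [this work] -/
theorem good_of_insert (hℓ : ∀ f ∈ E, ℓ ∈ f → f.IsDiag) (huℓ : u ≠ ℓ) (hsℓ : s ≠ ℓ) (R X : Set V) (hX : ℓ ∉ X)
    (hgood : ∀ F G : Set (Sym2 V) → ℝ, Monotone F → Monotone G → 0 ≤ Peel.tsum F G (insert s(u, ℓ) E) s R X)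
    {F G : Set (Sym2 V) → ℝ} (hF : Monotone F) (hG : Monotone G) : 0 ≤ Peel.tsum F G E s R X := by
  rw [tsum_eq_tsum_insert hℓ huℓ hsℓ R X hX F G]
  exact hgood _ _ (fun C D hCD => hF (Set.inter_subset_inter_left E hCD)) (fun C D hCD => hG (Set.inter_subset_inter_left E hCD))

/-- **Hanging a forest**: a chain `E₀ ⊆ E₁ ⊆ ⋯ ⊆ E_n`, each step attaching one pendant pair at a vertex meeting only loops (`≠ s`, `∉ X`),
preserves `T(R,X) ≥ 0 for all increasing F, G`. [this work] -/
theorem good_chain (Es : ℕ → Set (Sym2 V)) (s : V) (R X : Set V) (n : ℕ)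
    (h0 : ∀ F G : Set (Sym2 V) → ℝ, Monotone F → Monotone G → 0 ≤ Peel.tsum F G (Es 0) s R X)
    (hstep : ∀ i, i < n → ∃ u ℓ : V, s ≠ ℓ ∧ u ≠ ℓ ∧ ℓ ∉ X ∧ (∀ f ∈ Es i, ℓ ∈ f → f.IsDiag) ∧ Es (i + 1) = insert s(u, ℓ) (Es i)) :
    ∀ F G : Set (Sym2 V) → ℝ, Monotone F → Monotone G → 0 ≤ Peel.tsum F G (Es n) s R X := by
  induction n with
  | zero => exact h0
  | succ n ih =>
    obtain ⟨u, ℓ, hsℓ, huℓ, hX, hℓ, hE⟩ := hstep n (Nat.lt_succ_self n)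
    rw [hE]
    exact fun F G hF hG => good_insert hℓ huℓ hsℓ R X hX (ih fun i hi => hstep i (Nat.lt_succ_of_lt hi)) hF hG

/-- `T_E(R,∅)` is the bicluster-avoidance sum `BIC_E(R)` written out. [this work] -/
theorem tsum_empty_eq (F G : Set (Sym2 V) → ℝ) (E : Set (Sym2 V)) (s : V) (R : Set V) :
    Peel.tsum F G E s R ∅ = ∑ ω ∈ Finset.univ.filter (fun ω : Set (Sym2 V) =>
        ∀ r ∈ R, ¬ ((openGraph (ω ∩ E)).Reachable s r ∧ (openGraph (ωᶜ ∩ E)).Reachable s r)),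
      (F (openEdgeCluster (ω ∩ E) s) - F (openEdgeCluster (ωᶜ ∩ E) s)) *
        (G (openEdgeCluster (ω ∩ E) s) - G (openEdgeCluster (ωᶜ ∩ E) s)) := by
  have hset : Peel.tset E s R ∅ = Finset.univ.filter (fun ω : Set (Sym2 V) =>
      ∀ r ∈ R, ¬ ((openGraph (ω ∩ E)).Reachable s r ∧ (openGraph (ωᶜ ∩ E)).Reachable s r)) := by
    ext ω
    simp [Peel.mem_tset]
  unfold Peel.tsum Peel.delta
  rw [hset]

end Sums

end Pendant

end Antithetic

end Summit.CriticalPhenomena.PercolationContinuityZ3.Theorems
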